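import Summits.ValiantsHypothesis.ValiantsHypothesis.Theses.ShallowShadows
import Literature.Computability.AlgebraicComplexity.PermanentCompleteness
import Literature.Computability.AlgebraicComplexity.StandardFamilies
import Literature.Computability.Complexity.KWProtocol
import Summits.ValiantsHypothesis.ValiantsHypothesis.Theorems.ShallowShadowsShadowFormulaTransferStubKwFormula
import Summits.ValiantsHypothesis.ValiantsHypothesis.Theorems.ShallowShadowsShadowFormulaTransferDetProtocolRegimes
import Summits.ValiantsHypothesis.ValiantsHypothesis.Theorems.ShallowShadowsShadowFormulaTransferShadowOfArithExpr
import Summits.ValiantsHypothesis.ValiantsHypothesis.Theorems.ShallowShadowsShadowFormulaTransferShadowMulDominated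
import Summits.ValiantsHypothesis.ValiantsHypothesis.Theorems.ShallowShadowsShadowFormulaTransferShadowOfSos
import Summits.ValiantsHypothesis.ValiantsHypothesis.Theorems.ShallowShadowsShadowFormulaTransferKWOrAnd
import Summits.ValiantsHypothesis.ValiantsHypothesis.Theorems.ShadowFormulaTransfer.Negative.FalseWithoutZeroOne

/-!
# Crux `ShallowShadows.ShadowFormulaTransfer` (stmt-ValiantsHypothesis-17124), line `Sketch-ideator1`
# (positivity certificates) — CALIBRATION of the open stub `stub_positivityCertificate`

The line's open bet says: every `0/1` VP_ℂ family has, eventually in `n`, EITHER (M) a monotone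
arithmetic formula `φ` over `ℝ≥0` for a shadow-dominated nonnegative multiple `lift(f_n)·Q` of
size within the crux's budget, OR (S) an identity `lift(f_n)(x²)·q² = Σ_{i<T} c_i (Π_{j<k} G_ij)²`
(`c_i > 0`, `B f_n ≤ B q`, `deg G_ij ≤ A`) with `⌈log₂ T⌉ + ⌈log₂ k⌉ + A⌈log₂(N+1)⌉ + ⌈log₂ N⌉`
within the budget's exponent. This file makes the two "load-bearing" checks of the line card
kernel-checked facts, on top of the four LANDED transfer stubs:

* `kindM_size_ge_formulaSize`, `kindS_exponent_ge_formulaSize` — for ANY polynomial `g` over a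
  semiring, a certificate of either kind is at least as long as the monotone formula complexity
  of the shadow `B g` (this is the content of the composition `ShadowFormulaTransfer_of`, stated
  per instance). Hence, with `B(per_m) = PM_m` (`Negative.shadow_perPoly`):
* `two_pow_le_kindM_size_per`, `mul_le_kindS_exponent_per` — MODULO `RazWigdersonMatching`, every
  certificate of kind (M) for `per_m` has `φ.size ≥ 2^{c m}` and every certificate of kind (S) has
  exponent `≥ c m` (eventually in `m`): the far side of the crux in the line's own currency, i.e.
  `IsVPFamily` is load-bearing for the stub exactly as for X (`Negative.shadowFormulaTransfer_false_without_VP`).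
* `expand_detPoly_ne_sos` — the `{0,±1}` witness `det_m` (`m ≥ 2`) has NO certificate of kind (S)
  with `q = 1` at all: `det_m(x²)` is negative at a transposition matrix, a positive combination
  of squares is not. (Kind (M) is not even expressible for `det`: the line lifts by SUPPORT, and
  `lift(det_m) = lift(per_m)`; the `0/1` hypothesis is what makes the lift faithful.)

References: Jukna arXiv:1406.3065 Lemma 7; Raz–Wigderson 1992 (the far side, hypothesis
`RazWigdersonMatching`); Valiant 1980; the line card `Cruxes/ShadowFormulaTransfer/Lines/Sketch-ideator1.md`.
-/

-- Sub = Summit single-conjunct layout: the duplicated namespace component is mandated by the tree.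
set_option linter.dupNamespace false

noncomputable section

namespace Summit.ValiantsHypothesis.ValiantsHypothesis.Theorems.ShallowShadowsShadowFormulaTransfer

open Summit.ValiantsHypothesis.ValiantsHypothesis.Theses.ShallowShadows
open Literature.Computability.AlgebraicComplexity Literature.Computability.Complexity
open Literature.Barriers.PneNP
open scoped NNReal

/-! ### The characteristic lift -/

/-- The characteristic lift `Σ_{m ∈ supp g} x^m` of `g` over a nontrivial semiring `R` has the
same support as `g`. [folklore] -/
theorem support_charLift {ι : Type} {S : Type*} [CommSemiring S] (g : MvPolynomial ι S)
    (R : Type*) [CommSemiring R] [Nontrivial R] :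
    (∑ m ∈ g.support, MvPolynomial.monomial m (1 : R)).support = g.support := by
  classical
  ext m
  rw [MvPolynomial.mem_support_iff, MvPolynomial.coeff_sum]
  simp only [MvPolynomial.coeff_monomial]
  rw [Finset.sum_ite_eq']
  split_ifs with hm
  · simp [hm]
  · simp [hm]

/-- Hence the lift has the same shadow. [folklore] -/
theorem shadow_charLift_iff {ι : Type} {S : Type*} [CommSemiring S] (g : MvPolynomial ι S)
    (R : Type*) [CommSemiring R] [Nontrivial R] (a : ι → Bool) :
    (∃ m ∈ (∑ m ∈ g.support, MvPolynomial.monomial m (1 : R)).support,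
        ∀ i ∈ m.support, a i = true) ↔
      ∃ m ∈ g.support, ∀ i ∈ m.support, a i = true := by
  rw [support_charLift]

/-- Two `decide`-spellings of one Boolean function have the same monotone formula complexity
(bridges `Decidable` instances through the propositions). [folklore] -/
theorem formulaSizeOver_congr_prop {ι : Type} {B₁ B₀ : (ι → Bool) → Bool}
    (h : ∀ a, B₁ a = B₀ a) : formulaSizeOver monotoneBasis B₁ = formulaSizeOver monotoneBasis B₀ := by
  rw [show B₁ = B₀ from funext h]

/-! ### Kind (M): a certificate is at least as long as the shadow's monotone formula complexity -/

/-- **Kind (M) certificates bound the shadow's formula complexity** (per instance, for any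
Boolean spelling `B` of the shadow of `g`): if `φ` over `ℝ≥0` computes `lift(g)·Q` with
`B g ≤ B Q`, then `L(B g) ≤ φ.size` (landed stubs `stub_shadowMulDominated`,
`stub_shadowOfArithExpr`). [folklore] -/
theorem kindM_size_ge_formulaSize {ι : Type} [Fintype ι] {S : Type*} [CommSemiring S]
    (g : MvPolynomial ι S) (B : (ι → Bool) → Bool)
    (hB : ∀ a : ι → Bool, B a = true ↔ ∃ m ∈ g.support, ∀ i ∈ m.support, a i = true)
    (Q : MvPolynomial ι ℝ≥0) (φ : ArithExpr ℝ≥0 ι)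
    (hdom : ∀ a : ι → Bool, (∃ m ∈ g.support, ∀ i ∈ m.support, a i = true) →
      ∃ m ∈ Q.support, ∀ i ∈ m.support, a i = true)
    (heval : φ.eval = (∑ m ∈ g.support, MvPolynomial.monomial m (1 : ℝ≥0)) * Q) :
    formulaSizeOver monotoneBasis B ≤ φ.size := by
  have hmul := stub_shadowMulDominated ι _ Q
    (fun a ha => hdom a ((shadow_charLift_iff g ℝ≥0 a).mp ha))
  have hiff : ∀ a : ι → Bool, (∃ m ∈ φ.eval.support, ∀ i ∈ m.support, a i = true) ↔
      (B a = true) := by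
    intro a
    rw [heval, hB]
    exact (hmul a).trans (shadow_charLift_iff g ℝ≥0 a)
  rw [← formulaSizeOver_congr_prop (fun a => (Bool.eq_iff_iff.mpr
    ((decide_eq_true_iff (p := ∃ m ∈ φ.eval.support, ∀ i ∈ m.support, a i = true)).trans
      (hiff a))))]
  exact stub_shadowOfArithExpr ι φ

/-! ### Kind (S): the exponent of a certificate bounds the shadow's formula complexity -/

/-- **Phantom-freeness with a denominator**: if `p(x²) · q² = Σ_i c_i (Π_j G_ij)²` over `ℝ` with
`c_i > 0` and `B p ≤ B q`, then `B p = ∨_i ∧_j B(G_ij)` (the `q = 1` case is the landed stub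
`stub_shadowOfSos`; same proof on its landed helpers). [folklore] -/
theorem shadow_of_sos_denominator {ι : Type} (T k : ℕ) (c : Fin T → ℝ)
    (G : Fin T → Fin k → MvPolynomial ι ℝ) (p q : MvPolynomial ι ℝ) (hc : ∀ i, 0 < c i)
    (hdom : ∀ a : ι → Bool, (∃ m ∈ p.support, ∀ i ∈ m.support, a i = true) →
      ∃ m ∈ q.support, ∀ i ∈ m.support, a i = true)
    (hp : MvPolynomial.expand 2 p * q ^ 2 = ∑ i, MvPolynomial.C (c i) * (∏ j, G i j) ^ 2)
    (a : ι → Bool) :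
    (∃ m ∈ p.support, ∀ i ∈ m.support, a i = true) ↔
      ∃ i : Fin T, ∀ j : Fin k, ∃ m ∈ (G i j).support, ∀ l ∈ m.support, a l = true := by
  open MvPolynomial in
  have key : (∃ m ∈ p.support, ∀ i ∈ m.support, a i = true) ↔
      bind₁ (fun l => if a l then (X l : MvPolynomial ι ℝ) else 0) (expand 2 p * q ^ 2) ≠ 0 := by
    rw [map_mul, map_pow, mul_ne_zero_iff, pow_ne_zero_iff two_ne_zero,
      ← shadow_iff_restrictFace_ne_zero, ← shadow_iff_restrictFace_ne_zero, shadow_expand_two_iff]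
    exact ⟨fun h => ⟨h, hdom a h⟩, fun h => h.1⟩
  rw [key, hp]
  simp only [map_sum, map_mul, map_pow, map_prod, bind₁_C_right]
  rw [sum_ne_zero_iff_of_eval_nonneg Finset.univ _ fun i _ x => by
    rw [map_mul, eval_C, map_pow]
    exact mul_nonneg (hc i).le (sq_nonneg _)]
  simp only [Finset.mem_univ, true_and, ne_eq, mul_eq_zero, C_eq_zero, (hc _).ne', false_or,
    pow_eq_zero_iff two_ne_zero, Finset.prod_eq_zero_iff, not_exists,
    shadow_iff_restrictFace_ne_zero]

/-- **Kind (S) certificates bound the shadow's formula complexity** (per instance): from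
`lift(g)(x²)·q² = Σ_{i<T} c_i (Π_{j<k} G_ij)²` with `c_i > 0`, `B g ≤ B q`, `deg G_ij ≤ A`, on
`N ≥ 1` variables, `L(B g) ≤ 2^(⌈log₂ T⌉ + ⌈log₂ k⌉ + A ⌈log₂(N+1)⌉ + ⌈log₂ N⌉)` (phantom-freeness,
the width protocols of the factors, the `∨∧` combination `stub_kwOrAnd`, and KW `stub_kwFormula`).
[folklore] -/
theorem kindS_exponent_ge_formulaSize {ι : Type} [Fintype ι] [Nonempty ι] {S : Type*}
    [CommSemiring S] (g : MvPolynomial ι S) (B : (ι → Bool) → Bool)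
    (hB : ∀ a : ι → Bool, B a = true ↔ ∃ m ∈ g.support, ∀ i ∈ m.support, a i = true)
    (T k A : ℕ) (c : Fin T → ℝ) (q : MvPolynomial ι ℝ)
    (G : Fin T → Fin k → MvPolynomial ι ℝ) (hc : ∀ i, 0 < c i)
    (hdeg : ∀ i j, (G i j).totalDegree ≤ A)
    (hdom : ∀ a : ι → Bool, (∃ m ∈ g.support, ∀ i ∈ m.support, a i = true) →
      ∃ m ∈ q.support, ∀ i ∈ m.support, a i = true)
    (hexp : MvPolynomial.expand 2 (∑ m ∈ g.support, MvPolynomial.monomial m (1 : ℝ)) * q ^ 2 =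
      ∑ i, MvPolynomial.C (c i) * (∏ j, G i j) ^ 2) :
    formulaSizeOver monotoneBasis B ≤
      2 ^ (Nat.clog 2 T + Nat.clog 2 k + A * Nat.clog 2 (Fintype.card ι + 1) +
        Nat.clog 2 (Fintype.card ι)) := by
  set N := Fintype.card ι with hN
  have htrees : ∀ i j, ∃ P : KWTree ι,
      P.SolvesMono (fun a : ι → Bool =>
        decide (∃ m ∈ (G i j).support, ∀ l ∈ m.support, a l = true)) ∧
      P.depth ≤ A * Nat.clog 2 (N + 1) + Nat.clog 2 N := by
    intro i j
    have hk : (N + 1) ^ (G i j).totalDegree ≤ 2 ^ (A * Nat.clog 2 (N + 1)) :=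
      (Nat.pow_le_pow_right (Nat.succ_pos N) (hdeg i j)).trans (pow_le_two_pow_mul_clog N A)
    obtain ⟨P, hsol, hdepth⟩ :=
      exists_kwTree_shadow_width (G i j) (A * Nat.clog 2 (N + 1)) (Nat.clog 2 N) hk
        (Nat.le_pow_clog (by norm_num) _)
    exact ⟨P, fun a b ha hb => hsol a b (by simpa using ha) (by simpa using hb), hdepth⟩
  choose P hP hD using htrees
  have hiff : ∀ a : ι → Bool, (∃ m ∈ g.support, ∀ i ∈ m.support, a i = true) ↔
      ∃ i : Fin T, ∀ j : Fin k, ∃ m ∈ (G i j).support, ∀ l ∈ m.support, a l = true := by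
    intro a
    rw [← shadow_charLift_iff g ℝ a]
    refine shadow_of_sos_denominator T k c G _ q hc (fun a' ha' => hdom a' ?_) hexp a
    exact (shadow_charLift_iff g ℝ a').mp ha'
  obtain ⟨R, hsol, hdepth⟩ := exists_kwTree_or_and _ P hP hD B
    (fun a => by
      rw [hB, hiff a]
      simp only [decide_eq_true_iff])
  calc formulaSizeOver monotoneBasis B
      ≤ 2 ^ R.depth := stub_kwFormula ι _ R hsol
    _ ≤ _ := Nat.pow_le_pow_right (by norm_num) (by omega)

/-- `PM_m a ↔ B(per_m) a`, pointwise (`Negative.shadow_perPoly`). [folklore] -/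
theorem perfectMatchingFn_eq_true_iff_shadow_per (m : ℕ) (a : Fin m × Fin m → Bool) :
    perfectMatchingFn m a = true ↔
      ∃ d ∈ (perPoly (Fin m) ℂ).support, ∀ i ∈ d.support, a i = true := by
  have e := congrFun
    (Summit.ValiantsHypothesis.ValiantsHypothesis.Theorems.ShadowFormulaTransfer.Negative.shadow_perPoly m) a
  rw [← e]
  simp only [decide_eq_true_iff]

/-! ### The far side in the line's currency: certificates for `per` are long (mod RW92) -/

/-- **Kind (M) for the permanent is long** (modulo Raz–Wigderson): there are `c > 0`, `m₀` with
`2^{c m} ≤ φ.size` for every `m ≥ m₀` and every monotone `ℝ≥0`-formula `φ` computing a dominated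
multiple `lift(per_m)·Q` — the stub's kind (M) fails for `per` exactly as X does, so `IsVPFamily`
is load-bearing for it. [folklore] -/
theorem two_pow_le_kindM_size_per (hRW : RazWigdersonMatching) :
    ∃ c : ℝ, 0 < c ∧ ∃ m₀ : ℕ, ∀ m ≥ m₀, ∀ (Q : MvPolynomial (Fin m × Fin m) ℝ≥0)
      (φ : ArithExpr ℝ≥0 (Fin m × Fin m)),
      (∀ a : Fin m × Fin m → Bool,
        (∃ d ∈ (perPoly (Fin m) ℂ).support, ∀ i ∈ d.support, a i = true) →
          ∃ d ∈ Q.support, ∀ i ∈ d.support, a i = true) →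
      φ.eval = (∑ d ∈ (perPoly (Fin m) ℂ).support, MvPolynomial.monomial d (1 : ℝ≥0)) * Q →
      (2 : ℝ) ^ (c * m) ≤ φ.size := by
  obtain ⟨c, hc, m₀, hm₀⟩ := hRW
  refine ⟨c, hc, m₀, fun m hm Q φ hdom heval => ?_⟩
  have h1 := hm₀ m hm
  have h3 : formulaSizeOver monotoneBasis (perfectMatchingFn m) ≤ φ.size :=
    kindM_size_ge_formulaSize (perPoly (Fin m) ℂ) (perfectMatchingFn m)
      (perfectMatchingFn_eq_true_iff_shadow_per m) Q φ hdom heval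
  have h3R : (formulaSizeOver monotoneBasis (perfectMatchingFn m) : ℝ) ≤ (φ.size : ℝ) :=
    Nat.cast_le.mpr h3
  exact h1.trans h3R

/-- **Kind (S) for the permanent is long** (modulo Raz–Wigderson): there are `c > 0`, `m₀` such
that every certificate `lift(per_m)(x²)·q² = Σ_{i<T} c_i (Π_{j<k} G_ij)²` (`c_i > 0`,
`B(per_m) ≤ B q`, `deg G_ij ≤ A`) with `m ≥ m₀` has
`c·m ≤ ⌈log₂ T⌉ + ⌈log₂ k⌉ + A ⌈log₂(m²+1)⌉ + ⌈log₂ m²⌉`. [folklore] -/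
theorem mul_le_kindS_exponent_per (hRW : RazWigdersonMatching) :
    ∃ c : ℝ, 0 < c ∧ ∃ m₀ : ℕ, ∀ m ≥ m₀, ∀ (T k A : ℕ) (c' : Fin T → ℝ)
      (q : MvPolynomial (Fin m × Fin m) ℝ) (G : Fin T → Fin k → MvPolynomial (Fin m × Fin m) ℝ),
      (∀ i, 0 < c' i) → (∀ i j, (G i j).totalDegree ≤ A) →
      (∀ a : Fin m × Fin m → Bool,
        (∃ d ∈ (perPoly (Fin m) ℂ).support, ∀ i ∈ d.support, a i = true) →
          ∃ d ∈ q.support, ∀ i ∈ d.support, a i = true) →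
      MvPolynomial.expand 2 (∑ d ∈ (perPoly (Fin m) ℂ).support, MvPolynomial.monomial d (1 : ℝ)) *
          q ^ 2 = ∑ i, MvPolynomial.C (c' i) * (∏ j, G i j) ^ 2 →
      c * m ≤ ((Nat.clog 2 T + Nat.clog 2 k + A * Nat.clog 2 (Fintype.card (Fin m × Fin m) + 1) +
        Nat.clog 2 (Fintype.card (Fin m × Fin m)) : ℕ) : ℝ) := by
  obtain ⟨c, hc, m₀, hm₀⟩ := hRW
  refine ⟨c, hc, max m₀ 1, fun m hm T k A c' q G hc' hdeg hdom hexp => ?_⟩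
  have hm₀' : m₀ ≤ m := (le_max_left _ _).trans hm
  have hm1 : 1 ≤ m := (le_max_right _ _).trans hm
  haveI : Nonempty (Fin m × Fin m) := ⟨(⟨0, hm1⟩, ⟨0, hm1⟩)⟩
  have h1 := hm₀ m hm₀'
  have h2 := kindS_exponent_ge_formulaSize (perPoly (Fin m) ℂ) (perfectMatchingFn m)
    (perfectMatchingFn_eq_true_iff_shadow_per m) T k A c' q G hc' hdeg hdom hexp
  have h3 : (2 : ℝ) ^ (c * m) ≤ (2 : ℝ) ^ ((Nat.clog 2 T + Nat.clog 2 k +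
      A * Nat.clog 2 (Fintype.card (Fin m × Fin m) + 1) +
      Nat.clog 2 (Fintype.card (Fin m × Fin m)) : ℕ) : ℝ) := by
    refine h1.trans ?_
    have h2R : (formulaSizeOver monotoneBasis (perfectMatchingFn m) : ℝ) ≤
        ((2 ^ (Nat.clog 2 T + Nat.clog 2 k + A * Nat.clog 2 (Fintype.card (Fin m × Fin m) + 1) +
          Nat.clog 2 (Fintype.card (Fin m × Fin m))) : ℕ) : ℝ) := by exact_mod_cast h2
    refine h2R.trans (le_of_eq ?_)
    rw [Real.rpow_natCast]
    push_cast
    ring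
  exact (Real.rpow_le_rpow_left_iff (by norm_num : (1 : ℝ) < 2)).mp h3

/-! ### The `{0,±1}` witness has no certificate: `det(x²)` is not a sum of squares -/

/-- **`det_m(x²)` is not a positive combination of squares** (`m ≥ 2`): at the permutation matrix
of a transposition it takes the value `-1`, while every `Σ c_i (Π_j G_ij)²` with `c_i > 0` is
pointwise nonnegative. So the line's kind (S) certificate (with `q = 1`) does not exist for the
refuter's `{0,±1}`-coefficient witness `det`, as `Negative.shadowFormulaTransfer_false_with_unit_coefficients`
demands. [folklore] -/
theorem expand_detPoly_ne_sos {m : ℕ} (hm : 2 ≤ m) (T k : ℕ) (c : Fin T → ℝ)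
    (G : Fin T → Fin k → MvPolynomial (Fin m × Fin m) ℝ) (hc : ∀ i, 0 < c i) :
    MvPolynomial.expand 2 (detPoly (Fin m) ℝ) ≠ ∑ i, MvPolynomial.C (c i) * (∏ j, G i j) ^ 2 := by
  intro h
  -- the transposition `τ = (0 1)` and its permutation matrix as a point of `ℝ^{m × m}`
  have h0 : 0 < m := by omega
  have h1 : 1 < m := by omega
  set τ : Equiv.Perm (Fin m) := Equiv.swap ⟨0, h0⟩ ⟨1, h1⟩ with hτ
  set x : Fin m × Fin m → ℝ := fun p => if τ p.1 = p.2 then 1 else 0 with hx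
  have hsq : (fun p => x p ^ 2) = x := by
    funext p
    simp only [hx]
    split_ifs <;> norm_num
  -- left side: det of the permutation matrix of `τ`, i.e. `sign τ = -1`
  have hL : MvPolynomial.eval x (MvPolynomial.expand 2 (detPoly (Fin m) ℝ)) = -1 := by
    have hev : MvPolynomial.eval x (MvPolynomial.expand 2 (detPoly (Fin m) ℝ)) =
        MvPolynomial.eval (fun i => MvPolynomial.eval x (MvPolynomial.X i ^ 2))
          (detPoly (Fin m) ℝ) :=
      MvPolynomial.eval₂Hom_bind₁ _ _ _ _
    simp only [map_pow, MvPolynomial.eval_X] at hev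
    rw [hev, hsq, eval_detPoly]
    have hmat : (Matrix.of fun i j : Fin m => x (i, j)) = τ.permMatrix ℝ := by
      ext i j
      simp [hx, Equiv.Perm.permMatrix]
    rw [hmat, Matrix.det_permutation, hτ, Equiv.Perm.sign_swap (by simp [Fin.ext_iff])]
    simp
  -- right side: pointwise nonnegative
  have hR : 0 ≤ MvPolynomial.eval x (∑ i, MvPolynomial.C (c i) * (∏ j, G i j) ^ 2) := by
    rw [map_sum]
    refine Finset.sum_nonneg fun i _ => ?_
    rw [map_mul, MvPolynomial.eval_C, map_pow]
    exact mul_nonneg (hc i).le (sq_nonneg _)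
  rw [← h, hL] at hR
  linarith

end Summit.ValiantsHypothesis.ValiantsHypothesis.Theorems.ShallowShadowsShadowFormulaTransfer

end
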